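import Literature.MathematicalPhysics.QuantumLattice.TorusSectorGibbsMixture
import Literature.MathematicalPhysics.QuantumLattice.HubbardNNNHoppingCut
import Literature.MathematicalPhysics.QuantumLattice.PeierlsOrthonormalFamily
import HarnessLib

/-!
# The finite-temperature cluster variational principle: a cut of the lattice multiplies the
# canonical (spin-sector) partition functions

Family `hubbard` (topic `MathematicalPhysics/QuantumLattice`; positive-temperature companion of the
zero-temperature cut `ThermodynamicLimit.groundEnergy_twoGraph_le_add_of_cut` (`HubbardNNNHoppingCut`) and of
the open-cluster variational principle (`HubbardNNNHoppingOpenClusters`)). Written for the `T > 0` certificate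
family of the Hubbard cell (sr-mbsolver/hubbard-thermal, technique (ii)): it is the PRODUCER of certified
LOWER bounds on canonical log-partition functions (upper bounds on free energies) that carry ENTROPY — the
input `ℓ·L² ≤ log Z_{L,β}` of the chord theorems of `TorusSectorGibbsEnergyWindow`.

Setting (as in the zero-temperature cut): a two-graph Hamiltonian `H_{G,G'} = hamiltonian G t U + hamiltonian G' t' U'`
on a linearly ordered finite site set `Λ` which is the ordered disjoint union of blocks `Λ₁` (below, along
`e₁`) and `Λ₂` (above, along `e₂`); the block bond sets `G_i, G_i'` differ from the restrictions of `G, G'`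
on at most `k_i, k_i'` ordered pairs.

§1 **Spin sectors.** `spinConfig a b` — the occupation configurations with `a` up and `b` down electrons
(`TorusSectorGibbsMixture.szConfig n L` is `spinConfig k k`, `k = halfRectN n L`, definitionally), and the
**canonical-sector Hamiltonian** `spinSectorHamiltonian a b A = A.submatrix val val`, the compression to that
sector, whose Gibbs data are the canonical Gibbs state / partition function `Z_β(A; a, b)`.
§2 **Sector additivity of graded tensor products** (`isInSector_blockProd`): the product of block vectors
in the sectors `(a₁, b₁)`, `(a₂, b₂)` lies in the sector `(a₁ + a₂, b₁ + b₂)` (refines the tree's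
`isNParticle_prodVec`).
§3 **The cut multiplies partition functions** (`partitionFn_twoGraph_sector_cut`): for `β ≥ 0`,

  `e^{-β(2|t|(k₁+k₂) + 2|t'|(k₁'+k₂'))} · Re Z_β(H₁; a₁,b₁) · Re Z_β(H₂; a₂,b₂) ≤ Re Z_β(H_{G,G'}; a₁+a₂, b₁+b₂)`,

  proved by Peierls' inequality for the orthonormal family of graded tensor products `ψ¹_c ⊗ ψ²_d` of the
  sector eigenbases of the two blocks (`Matrix.IsHermitian.sum_exp_neg_mul_rayleigh_le_partitionFn_submatrix`),
  whose Rayleigh quotients are at most `λ¹_c + λ²_d + penalty` (`re_dotProduct_hamiltonian_blockProd_le`):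
  `Σ_{c,d} e^{-β(λ¹_c + λ²_d + pen)} = e^{-β pen} Z₁ Z₂`. For INDUCED block bond sets the penalties vanish
  (`partitionFn_twoGraph_sector_cut_of_induced`): `Z₁ · Z₂ ≤ Z` — the free energy of a product of cluster
  Gibbs states bounds the free energy from above with NO boundary term (fixed particle numbers per cluster
  kill every inter-cluster hopping expectation).
Everything is PROVED; the two definitions are concrete.

## References

* D. Ruelle, *Statistical Mechanics: Rigorous Results* (1969), §2.5–2.6 (Peierls and convexity inequalities
  for `tr e^{A}`), §3.3 Prop. 3.3.2 (b), eq. (3.5) (sub-box estimates). [cite: Ruelle1969, §3.3]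
* R. B. Israel, *Convexity in the Theory of Lattice Gases* (1979), Lemma II.3.1 and §I.3 eq. (26).
  [cite: Israel1979, Lemma II.3.1]
* B. Simon, *The Statistical Mechanics of Lattice Gases* I (1993), §II.8. [cite: Simon1993, §II.8]

## Mathlib / tree search

REUSED: `sectorEigenvector/sectorEigenvalue`, `star_sectorEigenvector_dotProduct`, `re_rayleigh_sectorEigenvector`
(`TorusSectorGibbsMixture` §1), `re_dotProduct_hamiltonian_blockProd_le` (`HubbardNNNHoppingCut`),
`dotProduct_prodVec`, `card_eq_card_filter_add_card_filter`, `strictMono_orbMap`, `orbMap_lt_orbMap`,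
`orbMap_cover` (`HubbardModelThermodynamicLimitProofs`), `IsInSector(.isNParticle)`, `upPart/downPart`,
`PreservesSectors`, `preservesSectors_hamiltonian` (`HubbardLiebConfig`, `HubbardWave0LiebProofs`),
`Matrix.IsHermitian.sum_exp_neg_mul_rayleigh_le_partitionFn_submatrix` (`PeierlsOrthonormalFamily`),
`Matrix.partitionFn_eq_sum_exp`. `lean search 'spinConfig|spinSector|partitionFn.*cut'` — nothing.
-/

noncomputable section

namespace Literature.MathematicalPhysics.QuantumLattice

open Matrix Finset HubbardWave0 ThermodynamicLimit LiebThm1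
open scoped ComplexOrder BigOperators

/-! ### §1 Spin sectors and the canonical-sector Hamiltonian -/

section SpinSector

variable {Λ : Type*} [LinearOrder Λ] [Fintype Λ]

/-- The occupation configurations of the spin sector `(N↑, N↓) = (a, b)`.
[cite: LiebPRL1989, proof of Theorem 1] -/
def spinConfig (a b : ℕ) (s : Finset (Orb Λ)) : Prop :=
  (upPart s).card = a ∧ (downPart s).card = b

/-- Membership in a spin sector is decidable (two cardinality equations). [folklore] -/
instance instDecidablePredSpinConfig (a b : ℕ) : DecidablePred (spinConfig (Λ := Λ) a b) :=
  fun _ => instDecidableAnd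

/-- Decidable equality of sector configurations, assembled from the ambient instance on
`Finset (Orb Λ)` through the linear order of `Λ` (recorded explicitly: at the concrete torus types the
default search exceeds `synthInstance.maxSize`, cf. `GaugedHubbardTorus.instDecidableEqIndex`;
`Decidable` instances are subsingletons, so nothing is overridden). [folklore] -/
instance instDecidableEqSubtypeSpinConfig (a b : ℕ) : DecidableEq (Subtype (spinConfig (Λ := Λ) a b)) :=
  @Subtype.instDecidableEq _ _ inferInstance

/-- A vector is in the sector `(a, b)` (`IsInSector`) iff it is supported in `spinConfig a b`.
[cite: LiebPRL1989, proof of Theorem 1] -/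
theorem isInSector_iff_support (a b : ℕ) (ψ : Fock (Orb Λ)) :
    IsInSector a b ψ ↔ ∀ s, ¬ spinConfig a b s → ψ s = 0 :=
  Iff.rfl

/-- The **canonical-sector Hamiltonian** `A|_{(a,b)}`: the compression of `A` to the spin sector
`(N↑, N↓) = (a, b)`. For a sector-preserving Hermitian `A` its Gibbs state is the canonical Gibbs state
and `Z_β(A|_{(a,b)}) = tr_{(a,b)} e^{-βA}` the canonical partition function. [cite: Israel1979, §I.3 eq. (26)] -/
def spinSectorHamiltonian (a b : ℕ) (A : Matrix (Finset (Orb Λ)) (Finset (Orb Λ)) ℂ) :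
    Matrix (Subtype (spinConfig (Λ := Λ) a b)) (Subtype (spinConfig (Λ := Λ) a b)) ℂ :=
  A.submatrix Subtype.val Subtype.val

/-- The compression of a Hermitian matrix to a spin sector is Hermitian (spectral theory in a
symmetry sector). [cite: Tasaki2020, §2.2] -/
theorem isHermitian_spinSectorHamiltonian (a b : ℕ) {A : Matrix (Finset (Orb Λ)) (Finset (Orb Λ)) ℂ}
    (hA : A.IsHermitian) : (spinSectorHamiltonian a b A).IsHermitian :=
  hA.submatrix Subtype.val

/-- A sector-preserving matrix has no entries between a spin sector and its complement.
[cite: LiebPRL1989, Remark (2)] -/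
theorem apply_eq_zero_of_preservesSectors {A : Matrix (Finset (Orb Λ)) (Finset (Orb Λ)) ℂ}
    (hA : PreservesSectors A) (a b : ℕ) (s s' : Finset (Orb Λ)) (hs : ¬ spinConfig a b s)
    (hs' : spinConfig a b s') : A s s' = 0 := by
  by_contra h
  have h2 := hA s s' h
  exact hs ⟨h2.1.trans hs'.1, h2.2.trans hs'.2⟩

/-- **The canonical partition function is the sector eigenvalue sum**:
`Re Z_β(A|_{(a,b)}) = Σ_c e^{-β λ_c}` over the eigenvalues of the compression
(`sectorEigenvalue`). [cite: Israel1979, Lemma II.3.1] -/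
theorem partitionFn_spinSectorHamiltonian_re (a b : ℕ) {A : Matrix (Finset (Orb Λ)) (Finset (Orb Λ)) ℂ}
    (hA : A.IsHermitian) (β : ℝ) :
    (partitionFn β (spinSectorHamiltonian a b A)).re =
      ∑ c, Real.exp (-(β * sectorEigenvalue (spinConfig a b) A hA c)) := by
  rw [(isHermitian_spinSectorHamiltonian a b hA).partitionFn_eq_ofReal, Complex.ofReal_re]
  rfl

end SpinSector

/-! ### §2 Sector additivity of graded tensor products -/

namespace ThermodynamicLimit

section BlockProd

section OneBlock

variable {Λ₁ Λ : Type*} [LinearOrder Λ₁] [Fintype Λ₁] [LinearOrder Λ] [Fintype Λ] {e₁ : Λ₁ → Λ}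

/-- The up-sites of a block's part of a configuration are the block's sites whose image is an up-site
of the configuration. [folklore] -/
private theorem upPart_blockConfig (s : Finset (Orb Λ)) :
    upPart ({p : Orb Λ₁ | orb (e₁ (ofLex p).1) (ofLex p).2 ∈ s} : Finset (Orb Λ₁)) =
      ({x : Λ₁ | e₁ x ∈ upPart s} : Finset Λ₁) := by
  ext x
  simp [upPart]

/-- The down-sites of a block's part of a configuration. [folklore] -/
private theorem downPart_blockConfig (s : Finset (Orb Λ)) :
    downPart ({p : Orb Λ₁ | orb (e₁ (ofLex p).1) (ofLex p).2 ∈ s} : Finset (Orb Λ₁)) =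
      ({x : Λ₁ | e₁ x ∈ downPart s} : Finset Λ₁) := by
  ext x
  simp [downPart]

end OneBlock

variable {Λ₁ Λ₂ Λ : Type*} [LinearOrder Λ₁] [Fintype Λ₁] [LinearOrder Λ₂] [Fintype Λ₂]
  [LinearOrder Λ] [Fintype Λ] {e₁ : Λ₁ → Λ} {e₂ : Λ₂ → Λ}

/-- **Spin-sector additivity of the graded tensor product**: if `ψ₁` lies in the sector `(a₁, b₁)` of
the lower block and `ψ₂` in the sector `(a₂, b₂)` of the upper block, their product lies in the sector
`(a₁ + a₂, b₁ + b₂)` (the numbers of up and of down electrons add over the blocks).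
[cite: Ruelle1969, §3.3] -/
theorem isInSector_blockProd (he₁ : Function.Injective e₁) (he₂ : Function.Injective e₂)
    (hne : ∀ x y, e₁ x ≠ e₂ y) (hcov : ∀ z, (∃ x, e₁ x = z) ∨ ∃ y, e₂ y = z)
    {a₁ b₁ a₂ b₂ : ℕ} {ψ₁ : Fock (Orb Λ₁)} {ψ₂ : Fock (Orb Λ₂)}
    (hψ₁ : IsInSector a₁ b₁ ψ₁) (hψ₂ : IsInSector a₂ b₂ ψ₂) :
    IsInSector (a₁ + a₂) (b₁ + b₂) (fun s : Finset (Orb Λ) =>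
      ψ₁ {p | orb (e₁ (ofLex p).1) (ofLex p).2 ∈ s} * ψ₂ {q | orb (e₂ (ofLex q).1) (ofLex q).2 ∈ s}) := by
  intro s hs
  have hup : (upPart s).card =
      (upPart ({p : Orb Λ₁ | orb (e₁ (ofLex p).1) (ofLex p).2 ∈ s} : Finset (Orb Λ₁))).card +
        (upPart ({q : Orb Λ₂ | orb (e₂ (ofLex q).1) (ofLex q).2 ∈ s} : Finset (Orb Λ₂))).card := by
    rw [upPart_blockConfig, upPart_blockConfig]
    exact card_eq_card_filter_add_card_filter he₁ he₂ hne hcov (upPart s)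
  have hdown : (downPart s).card =
      (downPart ({p : Orb Λ₁ | orb (e₁ (ofLex p).1) (ofLex p).2 ∈ s} : Finset (Orb Λ₁))).card +
        (downPart ({q : Orb Λ₂ | orb (e₂ (ofLex q).1) (ofLex q).2 ∈ s} : Finset (Orb Λ₂))).card := by
    rw [downPart_blockConfig, downPart_blockConfig]
    exact card_eq_card_filter_add_card_filter he₁ he₂ hne hcov (downPart s)
  simp only
  by_cases h1 : (upPart ({p : Orb Λ₁ | orb (e₁ (ofLex p).1) (ofLex p).2 ∈ s} : Finset (Orb Λ₁))).card = a₁ ∧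
      (downPart ({p : Orb Λ₁ | orb (e₁ (ofLex p).1) (ofLex p).2 ∈ s} : Finset (Orb Λ₁))).card = b₁
  · have h2 : ¬ ((upPart ({q : Orb Λ₂ | orb (e₂ (ofLex q).1) (ofLex q).2 ∈ s} : Finset (Orb Λ₂))).card = a₂ ∧
        (downPart ({q : Orb Λ₂ | orb (e₂ (ofLex q).1) (ofLex q).2 ∈ s} : Finset (Orb Λ₂))).card = b₂) := by
      intro h2
      exact hs ⟨by rw [hup, h1.1, h2.1], by rw [hdown, h1.2, h2.2]⟩
    rw [hψ₂ _ h2, mul_zero]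
  · rw [hψ₁ _ h1, zero_mul]

end BlockProd

/-! ### §3 The cut multiplies canonical partition functions -/

section TwoGraphCut

variable {Λ₁ Λ₂ Λ : Type*} [LinearOrder Λ₁] [Fintype Λ₁] [LinearOrder Λ₂] [Fintype Λ₂]
  [LinearOrder Λ] [Fintype Λ]

/-- Sector eigenvectors vanish off their sector (they are extensions by zero). [cite: Tasaki2020, §2.2] -/
theorem sectorEigenvector_apply_of_not_mem {ι : Type*} [Fintype ι] [DecidableEq ι] (p : ι → Prop)
    [DecidablePred p] (A : Matrix ι ι ℂ) (hA : A.IsHermitian) (a : Subtype p) {i : ι} (hi : ¬ p i) :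
    sectorEigenvector p A hA a i = 0 := by
  simp [sectorEigenvector, sectorExtend, hi]

/-- **The finite-temperature cut** (cluster variational principle for canonical partition functions).
In the setting of `groundEnergy_twoGraph_le_add_of_cut` (two bond sets `G, G'` on `Λ = Λ₁ ⊔ Λ₂`, block
bond sets `G_i, G_i'` with at most `k_i, k_i'` discrepant ordered pairs) and for `β ≥ 0`:
`e^{-β(2|t|(k₁+k₂) + 2|t'|(k₁'+k₂'))} · Re Z_β(H₁|_{(a₁,b₁)}) · Re Z_β(H₂|_{(a₂,b₂)}) ≤ Re Z_β(H|_{(a₁+a₂,b₁+b₂)})`,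
`H = hamiltonian G t U + hamiltonian G' t' U'`, `H_i` likewise on the blocks. Proof: Peierls' inequality
for the orthonormal family of graded tensor products of the two sector eigenbases.
[cite: Ruelle1969, §3.3] [cite: Israel1979, Lemma II.3.1] -/
theorem partitionFn_twoGraph_sector_cut (G₁ G₁' : SimpleGraph Λ₁) (G₂ G₂' : SimpleGraph Λ₂)
    (G G' : SimpleGraph Λ) [DecidableRel G₁.Adj] [DecidableRel G₁'.Adj] [DecidableRel G₂.Adj]
    [DecidableRel G₂'.Adj] [DecidableRel G.Adj] [DecidableRel G'.Adj]
    {e₁ : Λ₁ → Λ} {e₂ : Λ₂ → Λ} (he₁ : StrictMono e₁) (he₂ : StrictMono e₂)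
    (h12 : ∀ x y, e₁ x < e₂ y) (hcov : ∀ z, (∃ x, e₁ x = z) ∨ ∃ y, e₂ y = z)
    {k₁ k₂ k₁' k₂' : ℕ} (hk₁ : #{p : Λ₁ × Λ₁ | ¬ (G.Adj (e₁ p.1) (e₁ p.2) ↔ G₁.Adj p.1 p.2)} ≤ k₁)
    (hk₂ : #{p : Λ₂ × Λ₂ | ¬ (G.Adj (e₂ p.1) (e₂ p.2) ↔ G₂.Adj p.1 p.2)} ≤ k₂)
    (hk₁' : #{p : Λ₁ × Λ₁ | ¬ (G'.Adj (e₁ p.1) (e₁ p.2) ↔ G₁'.Adj p.1 p.2)} ≤ k₁')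
    (hk₂' : #{p : Λ₂ × Λ₂ | ¬ (G'.Adj (e₂ p.1) (e₂ p.2) ↔ G₂'.Adj p.1 p.2)} ≤ k₂')
    (t U t' U' : ℝ) {β : ℝ} (hβ : 0 ≤ β) (a₁ b₁ a₂ b₂ : ℕ) :
    Real.exp (-(β * (2 * |t| * (k₁ + k₂) + 2 * |t'| * (k₁' + k₂')))) *
        (partitionFn β (spinSectorHamiltonian a₁ b₁ (hamiltonian G₁ t U + hamiltonian G₁' t' U'))).re *
        (partitionFn β (spinSectorHamiltonian a₂ b₂ (hamiltonian G₂ t U + hamiltonian G₂' t' U'))).re ≤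
      (partitionFn β (spinSectorHamiltonian (a₁ + a₂) (b₁ + b₂)
        (hamiltonian G t U + hamiltonian G' t' U'))).re := by
  -- the three Hamiltonians
  set H₁ := hamiltonian G₁ t U + hamiltonian G₁' t' U' with hH₁def
  set H₂ := hamiltonian G₂ t U + hamiltonian G₂' t' U' with hH₂def
  set H := hamiltonian G t U + hamiltonian G' t' U' with hHdef
  have hH₁ : H₁.IsHermitian := (hamiltonian_isHermitian G₁ t U).add (hamiltonian_isHermitian G₁' t' U')
  have hH₂ : H₂.IsHermitian := (hamiltonian_isHermitian G₂ t U).add (hamiltonian_isHermitian G₂' t' U')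
  have hH : H.IsHermitian := (hamiltonian_isHermitian G t U).add (hamiltonian_isHermitian G' t' U')
  have hP₁ : PreservesSectors H₁ :=
    (preservesSectors_hamiltonian G₁ t U).add (preservesSectors_hamiltonian G₁' t' U')
  have hP₂ : PreservesSectors H₂ :=
    (preservesSectors_hamiltonian G₂ t U).add (preservesSectors_hamiltonian G₂' t' U')
  -- orbital maps
  have hO₁m : StrictMono (fun p : Orb Λ₁ => orb (e₁ (ofLex p).1) (ofLex p).2) := strictMono_orbMap he₁
  have hO₂m : StrictMono (fun q : Orb Λ₂ => orb (e₂ (ofLex q).1) (ofLex q).2) := strictMono_orbMap he₂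
  have hO12 : ∀ (p : Orb Λ₁) (q : Orb Λ₂),
      orb (e₁ (ofLex p).1) (ofLex p).2 < orb (e₂ (ofLex q).1) (ofLex q).2 := orbMap_lt_orbMap h12
  have hOcov := orbMap_cover (e₁ := e₁) (e₂ := e₂) hcov
  have hOne : ∀ (p : Orb Λ₁) (q : Orb Λ₂),
      orb (e₁ (ofLex p).1) (ofLex p).2 ≠ orb (e₂ (ofLex q).1) (ofLex q).2 := fun p q => (hO12 p q).ne
  have hene : ∀ x y, e₁ x ≠ e₂ y := fun x y => (h12 x y).ne
  -- the two sector eigenbases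
  set p₁ := spinConfig (Λ := Λ₁) a₁ b₁ with hp₁
  set p₂ := spinConfig (Λ := Λ₂) a₂ b₂ with hp₂
  set p := spinConfig (Λ := Λ) (a₁ + a₂) (b₁ + b₂) with hp
  set φ₁ : Subtype p₁ → Fock (Orb Λ₁) := sectorEigenvector p₁ H₁ hH₁ with hφ₁
  set φ₂ : Subtype p₂ → Fock (Orb Λ₂) := sectorEigenvector p₂ H₂ hH₂ with hφ₂
  set lam₁ : Subtype p₁ → ℝ := sectorEigenvalue p₁ H₁ hH₁ with hlam₁
  set lam₂ : Subtype p₂ → ℝ := sectorEigenvalue p₂ H₂ hH₂ with hlam₂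
  have hinv₁ : ∀ s s', ¬ p₁ s → p₁ s' → H₁ s s' = 0 :=
    fun s s' hs hs' => apply_eq_zero_of_preservesSectors hP₁ a₁ b₁ s s' hs hs'
  have hinv₂ : ∀ s s', ¬ p₂ s → p₂ s' → H₂ s s' = 0 :=
    fun s s' hs hs' => apply_eq_zero_of_preservesSectors hP₂ a₂ b₂ s s' hs hs'
  have hφ₁on : ∀ c c', star (φ₁ c) ⬝ᵥ φ₁ c' = if c = c' then 1 else 0 :=
    fun c c' => star_sectorEigenvector_dotProduct p₁ H₁ hH₁ c c'
  have hφ₂on : ∀ d d', star (φ₂ d) ⬝ᵥ φ₂ d' = if d = d' then 1 else 0 :=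
    fun d d' => star_sectorEigenvector_dotProduct p₂ H₂ hH₂ d d'
  have hφ₁sec : ∀ c, IsInSector a₁ b₁ (φ₁ c) :=
    fun c s hs => sectorEigenvector_apply_of_not_mem p₁ H₁ hH₁ c hs
  have hφ₂sec : ∀ d, IsInSector a₂ b₂ (φ₂ d) :=
    fun d s hs => sectorEigenvector_apply_of_not_mem p₂ H₂ hH₂ d hs
  have hφ₁E : ∀ c, (star (φ₁ c) ⬝ᵥ (H₁ *ᵥ φ₁ c)).re = lam₁ c :=
    fun c => re_rayleigh_sectorEigenvector p₁ hH₁ hinv₁ c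
  have hφ₂E : ∀ d, (star (φ₂ d) ⬝ᵥ (H₂ *ᵥ φ₂ d)).re = lam₂ d :=
    fun d => re_rayleigh_sectorEigenvector p₂ hH₂ hinv₂ d
  -- the product family
  set Ψ : Subtype p₁ × Subtype p₂ → Fock (Orb Λ) := fun cd s =>
    φ₁ cd.1 {q : Orb Λ₁ | orb (e₁ (ofLex q).1) (ofLex q).2 ∈ s} *
      φ₂ cd.2 {q : Orb Λ₂ | orb (e₂ (ofLex q).1) (ofLex q).2 ∈ s} with hΨ
  have hΨon : ∀ I J, star (Ψ I) ⬝ᵥ Ψ J = if I = J then 1 else 0 := by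
    rintro ⟨c, d⟩ ⟨c', d'⟩
    rw [hΨ]
    simp only
    rw [dotProduct_prodVec hO₁m.injective hO₂m.injective hOne hOcov, hφ₁on, hφ₂on]
    by_cases hc : c = c'
    · by_cases hd : d = d'
      · subst hc; subst hd; simp
      · simp [hd]
    · simp [hc]
  have hΨsupp : ∀ I s, ¬ p s → Ψ I s = 0 := by
    rintro ⟨c, d⟩ s hs
    exact isInSector_blockProd he₁.injective he₂.injective hene hcov (hφ₁sec c) (hφ₂sec d) s hs
  -- Rayleigh quotients of the product vectors
  set pen : ℝ := 2 * |t| * (k₁ + k₂) + 2 * |t'| * (k₁' + k₂') with hpen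
  have hΨE : ∀ I, (star (Ψ I) ⬝ᵥ (H *ᵥ Ψ I)).re ≤ lam₁ I.1 + lam₂ I.2 + pen := by
    rintro ⟨c, d⟩
    have hN : IsNParticle (a₁ + b₁) (φ₁ c) := (hφ₁sec c).isNParticle
    have hu₁ : star (φ₁ c) ⬝ᵥ φ₁ c = 1 := by rw [hφ₁on, if_pos rfl]
    have hu₂ : star (φ₂ d) ⬝ᵥ φ₂ d = 1 := by rw [hφ₂on, if_pos rfl]
    have h1 := re_dotProduct_hamiltonian_blockProd_le G₁ G₂ G he₁ he₂ h12 hcov hk₁ hk₂ t U hN hu₁ hu₂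
    have h2 := re_dotProduct_hamiltonian_blockProd_le G₁' G₂' G' he₁ he₂ h12 hcov hk₁' hk₂' t' U' hN
      hu₁ hu₂
    have hsum₁ := hφ₁E c
    have hsum₂ := hφ₂E d
    rw [hH₁def, add_mulVec, dotProduct_add, Complex.add_re] at hsum₁
    rw [hH₂def, add_mulVec, dotProduct_add, Complex.add_re] at hsum₂
    rw [hΨ]
    simp only
    rw [hHdef, add_mulVec, dotProduct_add, Complex.add_re, hpen]
    linarith
  -- Peierls' inequality for the product family, compressed to the sector `p`
  have hPe := hH.sum_exp_neg_mul_rayleigh_le_partitionFn_submatrix p β hΨon hΨsupp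
  refine le_trans ?_ hPe
  -- `Σ_{c,d} e^{-β(λ¹_c + λ²_d + pen)} ≤ Σ_{c,d} e^{-β Re⟨Ψ, HΨ⟩}`
  have hmono : ∑ I : Subtype p₁ × Subtype p₂, Real.exp (-(β * (lam₁ I.1 + lam₂ I.2 + pen))) ≤
      ∑ I, Real.exp (-(β * (star (Ψ I) ⬝ᵥ (H *ᵥ Ψ I)).re)) := by
    refine sum_le_sum fun I _ => Real.exp_le_exp.mpr ?_
    have := hΨE I
    nlinarith
  refine le_trans (le_of_eq ?_) hmono
  -- the left-hand side factorises
  rw [partitionFn_spinSectorHamiltonian_re a₁ b₁ hH₁, partitionFn_spinSectorHamiltonian_re a₂ b₂ hH₂,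
    Fintype.sum_prod_type, mul_assoc, Finset.sum_mul_sum, Finset.mul_sum]
  refine sum_congr rfl fun c _ => ?_
  rw [Finset.mul_sum]
  refine sum_congr rfl fun d _ => ?_
  rw [← Real.exp_add, ← Real.exp_add]
  congr 1
  ring

omit [LinearOrder Λ₁] [LinearOrder Λ] [Fintype Λ] in
/-- An induced bond set has no discrepant pairs. [folklore] -/
private theorem card_discrepancy_comap_le_zero (K : SimpleGraph Λ) [DecidableRel K.Adj] (f : Λ₁ ↪ Λ) :
    #{q : Λ₁ × Λ₁ | ¬ (K.Adj (f q.1) (f q.2) ↔ (K.comap f).Adj q.1 q.2)} ≤ 0 := by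
  rw [Nat.le_zero, Finset.card_eq_zero, Finset.filter_eq_empty_iff]
  intro q _
  simp [SimpleGraph.comap_adj]

/-- **Induced blocks: the cut multiplies canonical partition functions with no penalty.** If the block
bond sets are the restrictions of `G, G'` along the embeddings (open clusters: every bond joining the two
blocks is simply dropped), then for `β ≥ 0`
`Re Z_β(H₁|_{(a₁,b₁)}) · Re Z_β(H₂|_{(a₂,b₂)}) ≤ Re Z_β(H|_{(a₁+a₂,b₁+b₂)})`: the finite-temperature
cluster variational principle (the product of the cluster Gibbs states is a trial state whose free energy
is the sum of the cluster free energies). [cite: Ruelle1969, §3.3] [cite: Israel1979, Lemma II.3.1] -/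
theorem partitionFn_twoGraph_sector_cut_of_induced (G G' : SimpleGraph Λ) [DecidableRel G.Adj]
    [DecidableRel G'.Adj] {e₁ : Λ₁ ↪ Λ} {e₂ : Λ₂ ↪ Λ} (he₁ : StrictMono e₁) (he₂ : StrictMono e₂)
    (h12 : ∀ x y, e₁ x < e₂ y) (hcov : ∀ z, (∃ x, e₁ x = z) ∨ ∃ y, e₂ y = z) (t U t' U' : ℝ)
    {β : ℝ} (hβ : 0 ≤ β) (a₁ b₁ a₂ b₂ : ℕ) :
    (partitionFn β (spinSectorHamiltonian a₁ b₁
        (hamiltonian (G.comap e₁) t U + hamiltonian (G'.comap e₁) t' U'))).re *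
      (partitionFn β (spinSectorHamiltonian a₂ b₂
        (hamiltonian (G.comap e₂) t U + hamiltonian (G'.comap e₂) t' U'))).re ≤
      (partitionFn β (spinSectorHamiltonian (a₁ + a₂) (b₁ + b₂)
        (hamiltonian G t U + hamiltonian G' t' U'))).re := by
  have h := partitionFn_twoGraph_sector_cut (G.comap e₁) (G'.comap e₁) (G.comap e₂) (G'.comap e₂) G G'
    he₁ he₂ h12 hcov (card_discrepancy_comap_le_zero G e₁) (card_discrepancy_comap_le_zero G e₂)
    (card_discrepancy_comap_le_zero G' e₁) (card_discrepancy_comap_le_zero G' e₂) t U t' U' hβ a₁ b₁ a₂ b₂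
  simpa using h

end TwoGraphCut

end ThermodynamicLimit

end Literature.MathematicalPhysics.QuantumLattice
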